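import Summits.CriticalPhenomena.PercolationContinuityZ3.Theorems.PercNearOneGluingNoHeavyQuantMixedShift
import Summits.CriticalPhenomena.PercolationContinuityZ3.Theorems.PercNearOneGluingNoHeavyQuantSliceSingleLayer
import HarnessLib

/-!
# QUANT lane R8, T-DEC, leg (III): THE WINDOW FORM OF THE BLOB STEP (`WindowMixDEC`, the statement of record after V313/V317/V318),
# ITS SINGLE-LAYER DUAL FORM (`WindowMixSingleLayer`), and the reductions
# **`WindowMixSingleLayer → WindowMixDEC → (SDECUpTo x Q M μ → SDECUpTo x Q (M+a) (slice μ a g))`** (PM in full for every heavy blob)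

builds on p205010 (kernel theorem, internal audit signed; external expert review pending)

Statement + support file (`--supports stmt-CriticalPhenomena-4575`), QUANT lane lead seat prim-quant-lead (gen 31), rung R8 of
`run/shared/lean/prim/quant/LADDER.md`.  Two `@[conjecture]` definitions, one small definition (`LawDec.windowMixPullback`), theorems with
standard axioms, no sorries.  Continues lead g29's `…QuantMixedShift` (`shiftBut`, `gate_slice_eq_mix`, `sdecUpTo_slice_of_mixedShift` —
whose hypothesis `MixedShiftDEC` is REFUTED, `…QuantMixedShiftRefutation`), census-2 g55's `…QuantSliceSingleLayer` (`slicePullback`,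
`SliceSingleLayer`, `sliceClosedWindowT_of_singleLayer`) and the kernel strong duality `decAtT_iff_prices` (census-2 g56).

THE STATEMENT OF RECORD (README V318–V320, FOR-PROVERS-CW.md).  Every ONE-LAYER / single-datum form of the blob step is refuted in the kernel
(`not_mixedShiftDEC`, `not_twinMoveDEC`, `gateMoveBlob_general_witness`, `not_sliceClosed`); what survives every census is the WINDOW form
**CW = `WindowMixDEC`**: `ν` a probability law on `{0..M}` with mean `S`, top-affordable (`y·M ≤ S`), `0 ≤ z ≤ ν 0`, `g ≤ 1`, `y ≤ (1−z)·g`,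
`1 ≤ a`, a layer `j < M + a`; if `ν` is DEC at `(y, S, i)` for EVERY window layer `i ∈ [j−a, j]` (the layers `i ≥ M` are Theorem A), then the
mixture `P = (1−g)·ν + g·shiftBut ν a z` (`= slice ν a g + g z (δ₀ − δ_a) = z δ₀ + slice (ν − z δ₀) a g`, `windowMix_eq_slice_add`) is DEC at
`(y, S + a g (1−z), j)`.  With `ν = gate_q μ`, `z = 1 − q` this is `gate_q(slice μ a g)` DEC at layer `j` from the window of `gate_q μ`:
**`WindowMixDEC ⟹ SDECUpTo x Q M μ → SDECUpTo x Q (M+a) (slice μ a g)`** for every heavy blob (`sdecUpTo_slice_of_windowMix`), i.e. PM in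
full = the blob case of `GateMove` / `GatedConvEmptyFree` / `SingleGateConvClosed`.

THE DUAL FORM (lead g31, LEAD-NOTES-G31 N111–N113; the CW analogue of census-2 g55's single-layer domination, which is how the slice theorem
`sliceClosedWindowT_holds` was proved).  For a price system `(α, β)` of the positions `{0..M+a}` at `(t, j)`, `t = S + ag(1−z)`, write
`e = coefAt t j α β` and pull the weak-duality functional of `P` back to the atoms of `ν`:
`Σ_p e(p)·P(p) = Σ_k [(1−g)e(k) + g e(k+a)]·ν k + g z (e 0 − e a)` (`windowMix_functional_eq`).  **`WindowMixSingleLayer`**: there are ONE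
window layer `J` (`j−a ≤ J ≤ j`, `J ≤ M`), a mean tilt `m ∈ ℝ` and a zero-row multiplier `ζ ≥ 0` such that
`Φ′(k) := (1−g)e(k) + g e(k+a) + g z (e 0 − e a) − m (k − S) + ζ ([k = 0] − z)` is ITSELF a price system of `ν`'s atoms at `(S, J)`
(`Φ′ ≤ 0` on the `J`-absorbers, `Φ′(l) ≤ usage·(−Φ′(h))` on the `J`-compatible pairs).  Since `Σ_k Φ′(k) ν k = Σ_p e(p)P(p) + ζ (ν 0 − z) ≥
Σ_p e(p)P(p)` (mass `1`, mean `S`), weak duality at `J` plus strong duality for `P` give **`WindowMixSingleLayer → WindowMixDEC`**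
(`windowMixDEC_of_singleLayer`).  No law, no tilt other than the mean row, no TA row beyond the parameter inequalities `y·M ≤ S ≤ (1−z)·M`.

EVIDENCE (exact rational arithmetic; engines `run/sessions/…/prim-quant-lead-g31/explore/` = census-2 g55's integer double description
`dd.py` + lead g29's exact margin LP, cross-checked against census-2's `dec_lp_T`; kit j173052 on item 4575):
(E1) EXACT SUPPORT-LEVEL CENSUS of CW — for fixed `(atoms, S, y, a, j, g, z)` the CW-feasible laws form a polytope (window DEC cones ∩ mass ∩
mean ∩ `ν₀ ≥ z`), `P` is affine in `ν` and `D_y(t,j)` is convex, so CW on a support holds iff it holds at every VERTEX: 216 085 support ×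
parameter points (M ≤ 16, ≤ 6 atoms, `y` TA-tight / threshold-tight / doubly tight / interior, non-dominant layers favoured), 822 285 vertices,
**0 failures** (z = 0 control = the proved slice theorem, 0 failures as it must); (E2) per extreme ray of `P`'s dual cone: 71 360 rays on
7 488 instances, every non-trivial ray (25 251) SINGLE-LAYER dominated (6 945 need `ζ`, 2 518 need `m`), 0 multi-layer-only; random sums of
2–3 extreme rays 2 572 / 2 572; FULL supports `{0..M}` (the law-free binder below) 42 060 / 42 060 non-trivial rays (M ≤ 8, a ≤ 4); and the
LAYER RULE of census-2 g55 transfers VERBATIM — `J(e) = max(j − a, largest CHEAP window atom)`, cheap = pulled-back price below the cheapest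
`P`-giant's — certifying 35 934 / 35 934 non-trivial rays (top layer alone fails 107, bottom alone 105, 2 interior-only).
HONEST STATUS: `WindowMixDEC`, `WindowMixSingleLayer`, `GateMove`, `GatedConvEmptyFree`, `SingleGateConvClosed`, `SDECConvClosed`, `TreeDEC`,
`FarTreeRow` are OPEN; `MixedShiftDEC` / `TwinMoveDEC` / `SliceClosed` are FALSE (kernel).  The RATE class log\* and the honest sentence of
`run/shared/lean/prim/quant/README.md` are unchanged.

* `LawDec.WindowMixDEC` (`@[conjecture]`, CW).
* `LawDec.windowMixPullback`, `LawDec.WindowMixSingleLayer` (`@[conjecture]`, CW-SL).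
* `LawDec.windowMix_eq_slice_add`, `LawDec.windowMix_laws`, `LawDec.windowMix_functional_eq` — bookkeeping.
* **`LawDec.windowMixDEC_of_singleLayer : WindowMixSingleLayer → WindowMixDEC`.**
* **`LawDec.sdecUpTo_slice_of_windowMix : WindowMixDEC → (SDECUpTo x Q M μ → SDECUpTo x Q (M+a) (slice μ a g))`**, `LawDec.sdec_slice_of_windowMix`.

[this work]; slice theorem / single-layer domination: prim-quant-census-2 g55, prim-quant-stmt g24; `shiftBut`/mixture identity: lead g29;
refutations: prim-quant-arm-3 g62, lead g30, prim-quant-census-2 g54 (this lane).  Farkas [cite: Schrijver1986, Cor 7.1f (p. 90)].  The gluing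
rows served [cite: KozmaNitzan2024, Conjecture 3 (p. 15)]; product measure [cite: Grimmett1999, §1.3 p. 10].
-/

noncomputable section

namespace Summit.CriticalPhenomena.PercolationContinuityZ3.Theorems

namespace Quant

open Finset

namespace LawDec

/-! ### The window form CW -/

/-- **CONJECTURE CW (THE WINDOW FORM OF THE BLOB STEP; README V318, FOR-PROVERS-CW §2).**  `0 < y < 1`, `0 ≤ z ≤ ν 0`, `g ≤ 1`,
`y ≤ (1−z)·g`, `1 ≤ a`; `ν ≥ 0` a probability law on `{0..M}` with mean `S` and `y·M ≤ S` (top-affordable); a layer `j < M + a`.  If `ν` is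
DEC at `(y, S, i)` for every window layer `i` with `j − a ≤ i ≤ j` (for `i ≥ M` this is Theorem A, `decAt_of_top_le`), then the mixture
`(1−g)·ν + g·shiftBut ν a z` (`= slice ν a g + g z (δ₀ − δ_a)`) is DEC at `(y, S + a·g·(1−z), j)` (its mean).  With `ν = gate_q μ`, `z = 1 − q`
the mixture is `gate_q(slice μ a g)` (`gate_slice_eq_mix`, `gate_shift_eq_shiftBut`): PM in full (`sdecUpTo_slice_of_windowMix`).  KNOWN:
`z = 0` (the slice theorem `sliceClosedWindowT_holds`), `j < a` (`mixedShift_of_lt`), the dominant layers `2j < S + ag(1−z)` (arm-2 g34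
`gateConv_blob_decAt_dominant`), `a = 1` for SDEC laws (typer g27 `sdecUpTo_slice_relay`); every weakening to ONE layer or one datum is FALSE
(module docstring).  EVIDENCE: exact support-level vertex census, 0 / 216 085 points (822 285 vertices); module docstring.
builds on p205010 (kernel theorem, internal audit signed; external expert review pending). [this work] [status: open] -/
@[conjecture] def WindowMixDEC : Prop :=
  ∀ (y z g S : ℝ) (a j M : ℕ) (ν : ℕ → ℝ),
    0 < y → y < 1 → 0 ≤ z → z ≤ ν 0 → g ≤ 1 → y ≤ (1 - z) * g → 1 ≤ a →
    (∀ h, 0 ≤ ν h) → (∀ h, M < h → ν h = 0) → (∑ h ∈ Finset.range (M + 1), ν h = 1) →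
    S = ∑ h ∈ Finset.range (M + 1), (h : ℝ) * ν h → y * (M : ℝ) ≤ S →
    j < M + a →
    (∀ i, j ≤ i + a → i ≤ j → DECAtT y S i M ν) →
    DECAtT y (S + (a : ℝ) * g * (1 - z)) j (M + a) (fun h => (1 - g) * ν h + g * shiftBut ν a z h)

/-! ### The single-layer dual form CW-SL -/

/-- **pullback of a price functional of the mixture's positions to the atoms, with the mean tilt `m` and the zero row `ζ`**:
`Φ′(k) = (1−g)·e(k) + g·e(k+a) + g z (e 0 − e a) − m (k − S) + ζ ([k = 0] − z)`, `e = coefAt t j α β`. [this work] -/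
def windowMixPullback (t g z S m ζ : ℝ) (j a : ℕ) (α β : ℕ → ℝ) (k : ℕ) : ℝ :=
  (1 - g) * coefAt t j α β k + g * coefAt t j α β (k + a) + g * z * (coefAt t j α β 0 - coefAt t j α β a)
    - m * ((k : ℝ) - S) + ζ * ((if k = 0 then (1 : ℝ) else 0) - z)

/-- **CONJECTURE CW-SL (SINGLE-LAYER DOMINATION FOR THE WINDOW MIX; lead g31).**  For `0 < y < 1`, `0 ≤ z`, `g ≤ 1`, `y ≤ (1−z)·g`, `1 ≤ a`,
`j < M + a`, a target `S` with `y·M ≤ S ≤ (1−z)·M`, and ANY price system `(α, β)` of the positions `{0..M+a}` at target `t = S + ag(1−z)`,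
layer `j` (`β ≥ 0`; `α l ≤ usage·β h` for `l ≤ j`, `2l < t`, `h ≤ M + a` compatible): there are a window layer `J` (`j ≤ J + a`, `J ≤ j`,
`J ≤ M`), a real `m` and `ζ ≥ 0` such that `Φ′ = windowMixPullback t g z S m ζ j a α β` is a price system of target `S` at layer `J` on
`{0..M}`: `Φ′ h ≤ 0` for every `h ≤ M` that is not a `J`-low, and `Φ′ l ≤ usage y S J l h · (−Φ′ h)` for every `J`-low `l` and compatible
`h ≤ M`.  Implies `WindowMixDEC` (`windowMixDEC_of_singleLayer`).  EVIDENCE (exact, module docstring): every extreme ray of every tested dual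
cone (25 251 non-trivial on sparse supports, 42 060 on full supports `{0..M}`, M ≤ 8), random sums of rays; the layer rule `J = max(j−a, largest
cheap window atom)` of census-2 g55 certifies all of them (35 934 / 35 934 sparse, 42 060 / 42 060 full).
builds on p205010 (kernel theorem, internal audit signed; external expert review pending). [this work] [status: open] -/
@[conjecture] def WindowMixSingleLayer : Prop :=
  ∀ (y z g S : ℝ) (M a j : ℕ) (α β : ℕ → ℝ),
    0 < y → y < 1 → 0 ≤ z → g ≤ 1 → y ≤ (1 - z) * g → 1 ≤ a → j < M + a →
    y * (M : ℝ) ≤ S → S ≤ (1 - z) * M →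
    (∀ h, 0 ≤ β h) →
    (∀ l h, l ≤ j → 2 * (l : ℝ) < S + (a : ℝ) * g * (1 - z) → h ≤ M + a →
      (j + 1 ≤ h ∨ S + (a : ℝ) * g * (1 - z) < (l : ℝ) + h) →
      α l ≤ usage y (S + (a : ℝ) * g * (1 - z)) j l h * β h) →
    ∃ (J : ℕ) (m ζ : ℝ), j ≤ J + a ∧ J ≤ j ∧ J ≤ M ∧ 0 ≤ ζ ∧
      (∀ h, h ≤ M → ¬ (h ≤ J ∧ 2 * (h : ℝ) < S) →
        windowMixPullback (S + (a : ℝ) * g * (1 - z)) g z S m ζ j a α β h ≤ 0) ∧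
      (∀ l h, l ≤ J → 2 * (l : ℝ) < S → h ≤ M → (J + 1 ≤ h ∨ S < (l : ℝ) + h) →
        windowMixPullback (S + (a : ℝ) * g * (1 - z)) g z S m ζ j a α β l
          ≤ usage y S J l h * (- windowMixPullback (S + (a : ℝ) * g * (1 - z)) g z S m ζ j a α β h))

/-! ### Bookkeeping -/

/-- the mixture is the slice plus the moved zero mass: `(1−g)ν h + g·shiftBut ν a z h = slice ν a g h + g z ([h=0] − [h=a])`. [this work] -/
theorem windowMix_eq_slice_add (ν : ℕ → ℝ) (a : ℕ) (g z : ℝ) (h : ℕ) :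
    (1 - g) * ν h + g * shiftBut ν a z h
      = slice ν a g h + g * z * ((if h = 0 then (1 : ℝ) else 0) - (if h = a then (1 : ℝ) else 0)) := by
  simp only [shiftBut, slice]
  split_ifs <;> ring

/-- law facts of the mixture (`a ≥ 1`, `0 ≤ z ≤ ν 0`, `0 ≤ g ≤ 1`): nonnegative, vanishing above `M + a`, mass `1`, mean `S + ag(1−z)`. [this work] -/
theorem windowMix_laws (ν : ℕ → ℝ) (a M : ℕ) (g z : ℝ) (ha : 1 ≤ a) (hz0 : 0 ≤ z) (hzν : z ≤ ν 0) (hg0 : 0 ≤ g) (hg1 : g ≤ 1)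
    (hν0 : ∀ h, 0 ≤ ν h) (hνM : ∀ h, M < h → ν h = 0) (hν1 : ∑ h ∈ Finset.range (M + 1), ν h = 1) :
    (∀ h, 0 ≤ (1 - g) * ν h + g * shiftBut ν a z h) ∧
    (∀ h, M + a < h → (1 - g) * ν h + g * shiftBut ν a z h = 0) ∧
    (∑ h ∈ Finset.range (M + a + 1), ((1 - g) * ν h + g * shiftBut ν a z h) = 1) ∧
    (∑ h ∈ Finset.range (M + a + 1), (h : ℝ) * ((1 - g) * ν h + g * shiftBut ν a z h)
      = ∑ h ∈ Finset.range (M + 1), (h : ℝ) * ν h + (a : ℝ) * g * (1 - z)) := by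
  obtain ⟨w0, wM, w1, _⟩ := shiftBut_laws ν a M z ha hz0 hzν hν0 hνM hν1
  have hνM' : ∀ h, M + a < h → ν h = 0 := fun h hh => hνM h (by omega)
  refine ⟨fun h => by nlinarith [hν0 h, w0 h], fun h hh => by rw [hνM' h hh, wM h hh]; ring, ?_, ?_⟩
  · simp_rw [windowMix_eq_slice_add ν a g z]
    rw [Finset.sum_add_distrib, sum_slice ν a g M hνM hν1]
    have e : ∑ x ∈ Finset.range (M + a + 1), g * z * ((if x = 0 then (1 : ℝ) else 0) - (if x = a then (1 : ℝ) else 0)) = 0 := by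
      rw [← Finset.mul_sum, Finset.sum_sub_distrib, Finset.sum_ite_eq' (Finset.range (M + a + 1)) 0,
        Finset.sum_ite_eq' (Finset.range (M + a + 1)) a, if_pos (Finset.mem_range.2 (by omega)),
        if_pos (Finset.mem_range.2 (by omega))]
      ring
    rw [e, add_zero]
  · simp_rw [windowMix_eq_slice_add ν a g z]
    have e2 : ∀ h : ℕ, (h : ℝ) * (slice ν a g h + g * z * ((if h = 0 then (1 : ℝ) else 0) - (if h = a then (1 : ℝ) else 0)))
        = (h : ℝ) * slice ν a g h + g * z * ((if h = 0 then ((h : ℝ)) else 0) - (if h = a then ((h : ℝ)) else 0)) := by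
      intro h
      split_ifs <;> ring
    simp_rw [e2]
    rw [Finset.sum_add_distrib, sum_mul_slice ν a g M hνM hν1, ← Finset.mul_sum, Finset.sum_sub_distrib,
      Finset.sum_ite_eq' (Finset.range (M + a + 1)) 0, Finset.sum_ite_eq' (Finset.range (M + a + 1)) a,
      if_pos (Finset.mem_range.2 (by omega)), if_pos (Finset.mem_range.2 (by omega))]
    push_cast
    ring

/-- **the mixture's dual functional as a functional of the law**: for `ν` vanishing above `M` and any coefficients `e`,
`Σ_{p ≤ M+a} e(p)·P(p) = Σ_{k ≤ M} ((1−g)e(k) + g e(k+a))·ν k + g z (e 0 − e a)`. [this work] -/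
theorem windowMix_functional_eq (ν e : ℕ → ℝ) (M a : ℕ) (g z : ℝ) (hνM : ∀ h, M < h → ν h = 0) :
    ∑ p ∈ Finset.range (M + a + 1), e p * ((1 - g) * ν p + g * shiftBut ν a z p)
      = ∑ k ∈ Finset.range (M + 1), ((1 - g) * e k + g * e (k + a)) * ν k + g * z * (e 0 - e a) := by
  simp_rw [windowMix_eq_slice_add ν a g z]
  have e1 : ∀ p : ℕ, e p * (slice ν a g p + g * z * ((if p = 0 then (1 : ℝ) else 0) - (if p = a then (1 : ℝ) else 0)))
      = e p * slice ν a g p + g * z * ((if p = 0 then e p else 0) - (if p = a then e p else 0)) := by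
    intro p
    split_ifs <;> ring
  simp_rw [e1]
  rw [Finset.sum_add_distrib, slice_functional_eq ν e M a g hνM, ← Finset.mul_sum, Finset.sum_sub_distrib,
    Finset.sum_ite_eq' (Finset.range (M + a + 1)) 0, Finset.sum_ite_eq' (Finset.range (M + a + 1)) a,
    if_pos (Finset.mem_range.2 (by omega)), if_pos (Finset.mem_range.2 (by omega))]

/-- the pullback functional summed against a law of mass `1`, mean `S` on `{0..M}`:
`Σ_k Φ′(k) ν k = Σ_k ((1−g)e(k) + g e(k+a)) ν k + g z (e 0 − e a) + ζ (ν 0 − z)`. [this work] -/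
theorem sum_windowMixPullback (t g z S m ζ : ℝ) (j a M : ℕ) (α β ν : ℕ → ℝ)
    (hν1 : ∑ h ∈ Finset.range (M + 1), ν h = 1) (hS : S = ∑ h ∈ Finset.range (M + 1), (h : ℝ) * ν h) :
    ∑ k ∈ Finset.range (M + 1), windowMixPullback t g z S m ζ j a α β k * ν k
      = ∑ k ∈ Finset.range (M + 1), ((1 - g) * coefAt t j α β k + g * coefAt t j α β (k + a)) * ν k
        + g * z * (coefAt t j α β 0 - coefAt t j α β a) + ζ * (ν 0 - z) := by
  have e1 : ∀ k : ℕ, windowMixPullback t g z S m ζ j a α β k * ν k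
      = ((1 - g) * coefAt t j α β k + g * coefAt t j α β (k + a)) * ν k
        + (g * z * (coefAt t j α β 0 - coefAt t j α β a)) * ν k
        - m * ((k : ℝ) * ν k) + m * S * ν k + ζ * (if k = 0 then ν k else 0) - ζ * z * ν k := by
    intro k
    simp only [windowMixPullback]
    split_ifs <;> ring
  simp_rw [e1]
  rw [Finset.sum_sub_distrib, Finset.sum_add_distrib, Finset.sum_add_distrib, Finset.sum_sub_distrib, Finset.sum_add_distrib,
    ← Finset.mul_sum, ← Finset.mul_sum, ← Finset.mul_sum, ← Finset.mul_sum, ← Finset.mul_sum, hν1, ← hS,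
    Finset.sum_ite_eq' (Finset.range (M + 1)) 0, if_pos (Finset.mem_range.2 (Nat.succ_pos M))]
  ring

/-! ### `WindowMixSingleLayer → WindowMixDEC` -/

/-- **`WindowMixSingleLayer → WindowMixDEC`**: for a law `ν` DEC at target `S` at every window layer and a price system `(α, β)` of the
mixture at `(S + ag(1−z), j)`: weak duality at the dominating layer `J` with the system `Φ′` (`dual_le_of_decAtT`), the bookkeeping
`Σ Φ′ ν = Σ e P + ζ (ν 0 − z)` (`sum_windowMixPullback`, `windowMix_functional_eq`), `ν 0 ≥ z`, `ζ ≥ 0`, and strong duality for the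
mixture (`decAtT_iff_prices`). [this work] -/
theorem windowMixDEC_of_singleLayer (hS : WindowMixSingleLayer) : WindowMixDEC := by
  intro y z g S a j M ν hy0 hy1 hz0 hzν hg1 hyg ha hν0 hνM hν1 hSdef hta hjM hwin
  have hν01 : ν 0 ≤ 1 := by
    have h01 := Finset.single_le_sum (f := ν) (fun h _ => hν0 h) (Finset.mem_range.2 (Nat.succ_pos M))
    rwa [hν1] at h01
  have hg0 : 0 ≤ g := by
    by_contra hc
    have hng : (1 - z) * g ≤ 0 := mul_nonpos_of_nonneg_of_nonpos (by linarith [hzν, hν01]) (le_of_lt (not_le.1 hc))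
    linarith
  -- `S ≤ (1 − z)·M`: the mean of a law on `{0..M}` with zero atom `≥ z`
  have hSM : S ≤ (1 - z) * M := by
    have e1 : ∑ h ∈ Finset.range (M + 1), (h : ℝ) * ν h ≤ ∑ h ∈ Finset.range (M + 1), (M : ℝ) * (if h = 0 then 0 else ν h) := by
      refine Finset.sum_le_sum fun h hh => ?_
      have hhM : (h : ℝ) ≤ M := by exact_mod_cast Nat.lt_succ_iff.1 (Finset.mem_range.1 hh)
      by_cases h0 : h = 0
      · subst h0; simp
      · rw [if_neg h0]; exact mul_le_mul_of_nonneg_right hhM (hν0 h)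
    have e2 : ∑ h ∈ Finset.range (M + 1), (M : ℝ) * (if h = 0 then 0 else ν h) = (M : ℝ) * (1 - ν 0) := by
      rw [← Finset.mul_sum]
      congr 1
      have e3 : ∑ h ∈ Finset.range (M + 1), (if h = 0 then (0 : ℝ) else ν h)
          = ∑ h ∈ Finset.range (M + 1), ν h - ∑ h ∈ Finset.range (M + 1), (if h = 0 then ν h else 0) := by
        rw [← Finset.sum_sub_distrib]
        refine Finset.sum_congr rfl fun h _ => ?_
        split_ifs <;> ring
      rw [e3, hν1, Finset.sum_ite_eq' (Finset.range (M + 1)) 0, if_pos (Finset.mem_range.2 (Nat.succ_pos M))]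
    have hM0 : (0 : ℝ) ≤ M := Nat.cast_nonneg M
    rw [hSdef]
    nlinarith [e1, e2, hzν]
  -- law facts of the mixture
  obtain ⟨p0, pM, p1, pmean⟩ := windowMix_laws ν a M g z ha hz0 hzν hg0 hg1 hν0 hνM hν1
  set t : ℝ := S + (a : ℝ) * g * (1 - z) with ht
  rw [decAtT_iff_prices y t j (M + a) _ hy0 hy1 pM p1]
  intro α β hβ hαβ
  obtain ⟨J, m, ζ, hJ1, hJ2, hJM, hζ, habs, hlows⟩ := hS y z g S M a j α β hy0 hy1 hz0 hg1 hyg ha hjM hta hSM hβ hαβ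
  set Φ : ℕ → ℝ := windowMixPullback t g z S m ζ j a α β with hΦ
  set β' : ℕ → ℝ := fun h => if h ≤ M ∧ ¬ (h ≤ J ∧ 2 * (h : ℝ) < S) then -Φ h else 0 with hβ'
  have hβ'eq : ∀ k, k ≤ M → ¬ (k ≤ J ∧ 2 * (k : ℝ) < S) → β' k = -Φ k := by
    intro k hk hnl
    have hc : k ≤ M ∧ ¬ (k ≤ J ∧ 2 * (k : ℝ) < S) := And.intro hk hnl
    simp only [hβ', if_pos hc]
  have hβ'0 : ∀ h, 0 ≤ β' h := by
    intro h
    by_cases hc : h ≤ M ∧ ¬ (h ≤ J ∧ 2 * (h : ℝ) < S)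
    · rw [hβ'eq h hc.1 hc.2]; linarith [habs h hc.1 hc.2]
    · simp only [hβ', if_neg hc]; exact le_rfl
  have hαβ' : ∀ l h, l ≤ J → 2 * (l : ℝ) < S → h ≤ M → (J + 1 ≤ h ∨ S < (l : ℝ) + h) → Φ l ≤ usage y S J l h * β' h := by
    intro l h hlJ hlow hhM hcomp
    have hnl : ¬ (h ≤ J ∧ 2 * (h : ℝ) < S) := by
      rintro ⟨h1, h2⟩
      rcases hcomp with hc | hc
      · omega
      · linarith
    rw [hβ'eq h hhM hnl]
    exact hlows l h hlJ hlow hhM hcomp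
  -- weak duality at layer J
  have hdecJ : DECAtT y S J M ν := hwin J hJ1 hJ2
  have wd := dual_le_of_decAtT y S J M ν hy0 hy1 hdecJ Φ β' hβ'0 hαβ'
  have wd_eq := dual_functional_eq S J M Φ β' ν hJM
  have hcoef : ∀ k ∈ Finset.range (M + 1), coefAt S J Φ β' k * ν k = Φ k * ν k := by
    intro k hk
    rw [coefAt_pullback_eq S J M Φ β' hβ'eq k (Nat.lt_succ_iff.1 (Finset.mem_range.1 hk))]
  rw [Finset.sum_congr rfl hcoef] at wd_eq
  -- `Σ Φ ν = Σ Ψ ν + g z (e 0 − e a) + ζ (ν 0 − z)`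
  have hsumΦ := sum_windowMixPullback t g z S m ζ j a M α β ν hν1 hSdef
  -- the mixture's functional equals `Σ Ψ ν + g z (e 0 − e a)`
  have goal_eq := dual_functional_eq t j (M + a) α β (fun h => (1 - g) * ν h + g * shiftBut ν a z h) hjM.le
  rw [windowMix_functional_eq ν (coefAt t j α β) M a g z hνM] at goal_eq
  have hζν : 0 ≤ ζ * (ν 0 - z) := mul_nonneg hζ (by linarith)
  rw [hΦ] at wd_eq
  linarith [goal_eq, wd, wd_eq, hsumΦ, hζν]

/-! ### PM in full from CW -/

/-- **`WindowMixDEC ⟹ SDEC-UP-TO-`Q` IS CLOSED UNDER SLICING BY ANY HEAVY BLOB `{0, a; g}`** (`x ≤ g ≤ 1`, `a ≥ 1`): `μ` a top-affordable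
probability law on `{0..M}`, SDEC up to `Q` at floor `x` (`0 < x`, `Q ≤ 1`, `Qx < 1`) ⟹ `slice μ a g` is SDEC up to `Q` at `x` on `{0..M+a}`.
Per gate `q ≤ Q` and layer `j < M + a`: `gate_q(slice μ a g) = (1−g)·ν + g·shiftBut ν a (1−q)` with `ν = gate_q μ` (`gate_slice_eq_mix`,
`gate_shift_eq_shiftBut`); `ν` is DEC at `(qx, qT, i)` for every window layer `i` — by `SDECUpTo` for `i < M`, by Theorem A (`decAt_of_top_le`)
for `i ≥ M`; CW concludes (`y = qx ≤ q·g = (1−z)g`, `z = 1−q ≤ ν 0`).  PM in full — the blob case of leg (III) — modulo CW. [this work] -/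
theorem sdecUpTo_slice_of_windowMix (hCW : WindowMixDEC) (x Q g : ℝ) (a M : ℕ) (μ : ℕ → ℝ) (hx0 : 0 < x)
    (hQ1 : Q ≤ 1) (hQx : Q * x < 1) (hxg : x ≤ g) (hg1 : g ≤ 1) (ha : 1 ≤ a)
    (hμ0 : ∀ h, 0 ≤ μ h) (hμM : ∀ h, M < h → μ h = 0) (hμ1 : ∑ h ∈ Finset.range (M + 1), μ h = 1)
    (hta : x * (M : ℝ) ≤ ∑ h ∈ Finset.range (M + 1), (h : ℝ) * μ h)
    (hS : SDECUpTo x Q M μ) :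
    SDECUpTo x Q (M + a) (slice μ a g) := by
  intro q hq0 hqQ j hj
  set T : ℝ := ∑ h ∈ Finset.range (M + 1), (h : ℝ) * μ h with hT
  set y : ℝ := q * x with hy
  have hq1 : q ≤ 1 := hqQ.trans hQ1
  have hy0 : 0 < y := mul_pos hq0 hx0
  have hy1 : y < 1 := lt_of_le_of_lt (mul_le_mul_of_nonneg_right hqQ hx0.le) hQx
  have hyqg : y ≤ (1 - (1 - q)) * g := by rw [hy, sub_sub_cancel]; exact mul_le_mul_of_nonneg_left hxg hq0.le
  obtain ⟨n0, nM, n1⟩ := gate_laws M μ q hq0.le hq1 hμ0 hμM hμ1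
  have nmean : ∑ h ∈ Finset.range (M + 1), (h : ℝ) * gate μ q h = q * T := sum_mul_gate μ q M
  have htaν : y * (M : ℝ) ≤ q * T := by rw [hy, mul_assoc]; exact mul_le_mul_of_nonneg_left hta hq0.le
  have hzν : 1 - q ≤ gate μ q 0 := by rw [gate_apply, if_pos rfl]; nlinarith [hμ0 0]
  -- the window: `gate_q μ` DEC at every layer `i` (SDEC below the top, Theorem A at or above it)
  have hwin : ∀ i, j ≤ i + a → i ≤ j → DECAtT y (q * T) i M (gate μ q) := by
    intro i _ _
    by_cases hiM : i < M
    · have := hS q hq0 hqQ i hiM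
      rwa [decAt_iff_decAtT, nmean] at this
    · have htop : ∀ h, 0 < gate μ q h → y * (h : ℝ) ≤ ∑ k ∈ Finset.range (M + 1), (k : ℝ) * gate μ q k := by
        intro h hh
        have hhM : h ≤ M := by
          by_contra hc
          exact (ne_of_gt hh) (nM h (not_le.1 hc))
        rw [nmean]
        have : y * (h : ℝ) ≤ y * M := mul_le_mul_of_nonneg_left (by exact_mod_cast hhM) hy0.le
        linarith
      have := decAt_of_top_le M (gate μ q) n0 nM n1 y hy1 htop i (not_lt.1 hiM)
      rwa [decAt_iff_decAtT, nmean] at this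
  have hcw := hCW y (1 - q) g (q * T) a j M (gate μ q) hy0 hy1 (by linarith) hzν hg1 hyqg ha n0 nM n1 nmean.symm htaν hj hwin
  have hsmean : ∑ h ∈ Finset.range (M + a + 1), (h : ℝ) * slice μ a g h = T + (a : ℝ) * g := sum_mul_slice μ a g M hμM hμ1
  rw [decAt_iff_decAtT, sum_mul_gate, hsmean, gate_slice_eq_mix, gate_shift_eq_shiftBut μ q a ha]
  convert hcw using 2
  ring

/-- **`WindowMixDEC ⟹ SDEC IS CLOSED UNDER SLICING BY ANY HEAVY BLOB`** (`Q = 1`): `0 < x < 1`, `x ≤ g ≤ 1`, `a ≥ 1`, `μ` a top-affordable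
probability law on `{0..M}`, SDEC at `x` ⟹ `slice μ a g` is SDEC at `x` on `{0..M+a}`. [this work] -/
theorem sdec_slice_of_windowMix (hCW : WindowMixDEC) (x g : ℝ) (a M : ℕ) (μ : ℕ → ℝ) (hx0 : 0 < x) (hx1 : x < 1)
    (hxg : x ≤ g) (hg1 : g ≤ 1) (ha : 1 ≤ a) (hμ0 : ∀ h, 0 ≤ μ h) (hμM : ∀ h, M < h → μ h = 0)
    (hμ1 : ∑ h ∈ Finset.range (M + 1), μ h = 1)
    (hta : x * (M : ℝ) ≤ ∑ h ∈ Finset.range (M + 1), (h : ℝ) * μ h) (hS : SDEC x M μ) :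
    SDEC x (M + a) (slice μ a g) := by
  rw [← sdecUpTo_one_iff] at hS ⊢
  exact sdecUpTo_slice_of_windowMix hCW x 1 g a M μ hx0 le_rfl (by rwa [one_mul]) hxg hg1 ha hμ0 hμM hμ1 hta hS

end LawDec

end Quant

end Summit.CriticalPhenomena.PercolationContinuityZ3.Theorems
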